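import Summits.ABC.StewartYu.SatCoords
import Summits.ABC.StewartYu.ArchG3HalfSupply
import HarnessLib

/-!
# Cell abc-stewartyu, rung A1.L (crux r2 `ArchCoreRat`), WP-L.A under the ONE-STAGE ruling R32/R34: the SATURATION DATUM of an
# archimedean Gen-3 set-up — virtual coordinates, VIRTUAL (α-charged) monomial sizes and clearing denominators for the k-step box
# and the half-step floor box

`Summits/ABC/StewartYu/ArchG3SatData.lean` — cell `abc-stewartyu` (HOME `run/shared/lean/pub/abc-stewartyu/`; plan RULINGS R32 (one stage,
Θ′ from the start) and R34 («virtual monomial atoms at every level»); seat p5 g8).  One structure and theorems on `ArchG3Setup`; no named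
fact, no parameters.  Archimedean re-keying of p2's `PadicG3SatData` (seat p2-g6, crux r3): the frame runs on a SATURATED basis
`θ = S.α` of the group generated by the ORIGINAL positive rationals `αo`, and every size / denominator of a monomial `∏ θᵢ^{μᵢ}` is
charged through its VIRTUAL exponent vector `ν(μ) = μ ᵥ* U` (`= N·λ`, `λ` the `αo`-coordinates; Nesterenko 2003 §3.4–3.5, §4.3 (4.50);
print's Lemma 3.11 sizes `2^{−s}·n·L·|x|` are the virtual ones).  `S.SatData` records

  `S.α i ^ N = ∏ⱼ αo j ^ U i j`,  `αo j = ∏ᵢ S.α i ^ C j i`,  `U * C = N • 1 = C * U`,  `S.b = bo ᵥ* C`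

(field names as in `G3Setup.SatData`, so a START builds both from the same `SatKit`; `θ > 0` is automatic here: `S.α_pos`).  From it:
coordinates (`N_smul_eq_vecMul_vecMul`, `N_smul_bo_eq`, `exists_bo_ne_zero`, **`abs_le_of_vbox`** = θ-box from the virtual box, **`Λ_eq_sum_bo`** =
the linear form is the ORIGINAL one); VIRTUAL REAL SIZES, the F = 1 atoms of R34 (`natCast_N_mul_lg`, `natCast_N_mul_Lsum`,
**`abs_Lsum_le_of_vbox`** `|Lsum μ| ≤ Σⱼ(Bvⱼ/N)Aoⱼ`, `abs_lg_le_of_weights`, `logHeight₁_le_of_sat`, **`log_heightProd_le_of_sat`** = the (s2)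
radicand heights); the k-step box (`Ev`, **`Dmv Bv x = monDen αo ⌈Bv|x|/N⌉`**, `exists_int_Dmv_mul_prod`, `log_Dmv_le_of_weights`); the half-step
floor box (`colU`, `Ehv`, **`Dhv Bv s = monDen αo ⌈(|s|Bv + Σᵢ|Uᵢ·|)/(2N)⌉`**, `two_mul_abs_vecMul_halfExp_le`, **`exists_int_Dhv_mul_qEhZ`**,
`log_Dhv_le_of_weights`, **`qEhZ_le_exp_of_vbox`** = the virtual size of the rational part at `s/2`).

WHAT THIS IS NOT: no lattice (`SatKit`/`SatBasisReduced`/`SatFrameKit` produce `θ, U, C, N`); no packs (`archKStepHypU_of_ineqV` /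
`archHalfStepHypU_of_ineqV` follow lp-1's re-quantified pack texts, R34 (2)); no crux moves.

## References
* Yu. V. Nesterenko, *Linear forms in logarithms of rational numbers*, LNM 1819 (2003) — §3.4 (3.16)–(3.21) p. 69–71, §3.5 (3.23), Lemma 3.11
  p. 72–74, §4.3 (4.50) and Cor. 4.5 p. 94. [Nesterenko2003]
* K. Yu, Acta Math. 211 (2013) — §1.1 p. 319 (the saturated basis; cell files `SatCoords`, `PadicG3SatData`). [Yu2013]
-/

noncomputable section

open Finset
open scoped Matrix
open Literature.NumberTheory.Transcendental
open Literature.NumberTheory.Transcendental.CW77 (heightProd hgt)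

namespace Summit.ABC.StewartYu

namespace ArchG3Setup

variable (S : ArchG3Setup)

/-- **The saturation datum of an archimedean set-up**: ORIGINAL positive generators `αo` and coefficients `bo`, integer matrices
`U`, `C` and the index `0 < N` with `θᵢ^N = ∏ⱼ αoⱼ^{Uᵢⱼ}` (`θ = S.α`), `αoⱼ = ∏ᵢ θᵢ^{Cⱼᵢ}`, `U·C = N·1 = C·U`, `S.b = bo ᵥ* C`.
[cite: Nesterenko2003, §3.4–3.5 and Cor 4.5; shape only] -/
structure SatData where
  /-- the original generators -/
  αo : Fin S.n → ℚ
  /-- they are positive -/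
  hαo : ∀ j, 0 < αo j
  /-- the integer matrix `N·ū` (`θᵢ^N = αo^{Uᵢ}`) -/
  U : Matrix (Fin S.n) (Fin S.n) ℤ
  /-- the integer coordinates of the original generators in the basis (`αoⱼ = θ^{Cⱼ}`) -/
  C : Matrix (Fin S.n) (Fin S.n) ℤ
  /-- the saturation index -/
  N : ℕ
  /-- it is positive -/
  hN : 0 < N
  /-- `θᵢ^N = ∏ⱼ αoⱼ^{Uᵢⱼ}` -/
  hU : ∀ i, S.α i ^ N = ∏ j, αo j ^ U i j
  /-- `αoⱼ = ∏ᵢ θᵢ^{Cⱼᵢ}` -/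
  hC : ∀ j, αo j = ∏ i, S.α i ^ C j i
  /-- `U·C = N·1` -/
  hUC : U * C = (N : ℤ) • (1 : Matrix (Fin S.n) (Fin S.n) ℤ)
  /-- `C·U = N·1` -/
  hCU : C * U = (N : ℤ) • (1 : Matrix (Fin S.n) (Fin S.n) ℤ)
  /-- the original coefficients -/
  bo : Fin S.n → ℤ
  /-- the set-up's coefficients are the transported ones: `bᵢ = Σⱼ boⱼ Cⱼᵢ` -/
  hb : S.b = bo ᵥ* C

namespace SatData

variable {S} (F : S.SatData)

/-! ### Coordinates -/

/-- The original generators are non-zero. [folklore] -/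
theorem αo_ne (j : Fin S.n) : F.αo j ≠ 0 := (F.hαo j).ne'

/-- The original generators are positive reals. [folklore] -/
theorem αo_pos' (j : Fin S.n) : (0 : ℝ) < (F.αo j : ℝ) := by exact_mod_cast F.hαo j

/-- `(0 : ℝ) < N`. [folklore] -/
theorem N_pos' : (0 : ℝ) < F.N := by exact_mod_cast F.hN

/-- **`N • μ = ν(μ) ᵥ* C`**: the θ-coordinates are recovered from the virtual ones `ν(μ) = μ ᵥ* U`. [folklore] -/
theorem N_smul_eq_vecMul_vecMul (μ : Fin S.n → ℤ) : (F.N : ℤ) • μ = (μ ᵥ* F.U) ᵥ* F.C := by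
  rw [Matrix.vecMul_vecMul, F.hUC, Matrix.vecMul_smul, Matrix.vecMul_one]

/-- **`N • bo = ν(b)`**: the virtual coordinates of the set-up's coefficient vector. [folklore] -/
theorem N_smul_bo_eq : (F.N : ℤ) • F.bo = S.b ᵥ* F.U := by
  rw [F.hb, Matrix.vecMul_vecMul, F.hCU, Matrix.vecMul_smul, Matrix.vecMul_one]

/-- Some original coefficient is non-zero (as `b_{j₀} ≠ 0`). [folklore] -/
theorem exists_bo_ne_zero : ∃ j, F.bo j ≠ 0 := by
  by_contra h0
  push Not at h0
  have hb0 : F.bo = 0 := funext h0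
  have h := F.hb
  rw [hb0, Matrix.zero_vecMul] at h
  exact S.bj₀_ne (by rw [h]; rfl)

/-- **The θ-box from the virtual box, consumable form**: if `|ν(μ)ⱼ| ≤ Bvⱼ` for all `j` and `Σⱼ Bvⱼ·|Cⱼₖ| ≤ N·Lθₖ`, then `|μₖ| ≤ Lθₖ`.
[cite: Nesterenko2003, §3.5 (3.25); shape only] -/
theorem abs_le_of_vbox {Bv Lθ : Fin S.n → ℕ} {μ : Fin S.n → ℤ} (h : ∀ j, |(μ ᵥ* F.U) j| ≤ (Bv j : ℤ))
    (hL : ∀ k, ∑ j, (Bv j : ℤ) * |F.C j k| ≤ (F.N : ℤ) * Lθ k) (k : Fin S.n) : |μ k| ≤ (Lθ k : ℤ) := by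
  have e := congrFun (F.N_smul_eq_vecMul_vecMul μ) k
  simp only [Pi.smul_apply, smul_eq_mul] at e
  have e2 : (F.N : ℤ) * μ k = ∑ j, (μ ᵥ* F.U) j * F.C j k := by rw [e]; rfl
  have hN0 : (0 : ℤ) < F.N := by exact_mod_cast F.hN
  have h1 : (F.N : ℤ) * |μ k| ≤ (F.N : ℤ) * Lθ k := by
    calc (F.N : ℤ) * |μ k| = |(F.N : ℤ) * μ k| := by rw [abs_mul, abs_of_pos hN0]
      _ = |∑ j, (μ ᵥ* F.U) j * F.C j k| := by rw [e2]
      _ ≤ ∑ j, |(μ ᵥ* F.U) j * F.C j k| := abs_sum_le_sum_abs _ _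
      _ ≤ ∑ j, (Bv j : ℤ) * |F.C j k| := sum_le_sum fun j _ => by
          rw [abs_mul]; exact mul_le_mul_of_nonneg_right (h j) (abs_nonneg _)
      _ ≤ (F.N : ℤ) * Lθ k := hL k
  exact le_of_mul_le_mul_left h1 hN0

/-- **The linear form is the original one**: `Λ = Σᵢ bᵢ log θᵢ = Σⱼ boⱼ log αoⱼ` (`exp Λ = ∏ θᵢ^{bᵢ} = ∏ αoⱼ^{boⱼ}`) — the negated crux
bound on `|Λ|` and the frame's `Λ/b_{j₀}` speak about the SAME number. [cite: Nesterenko2003, §3.5 (the form Λ in the basis θ); shape only] -/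
theorem Λ_eq_sum_bo : S.Λ = ∑ j, (F.bo j : ℝ) * Real.log (F.αo j : ℝ) := by
  have hexp : Real.exp S.Λ = ∏ j, (F.αo j : ℝ) ^ F.bo j := by
    rw [S.exp_Λ, F.hb]
    exact_mod_cast congrArg (fun q : ℚ => (q : ℝ)) (SatCoords.prod_zpow_vecMul_eq F.αo S.α S.α_ne F.C F.hC F.bo)
  have h := congrArg Real.log hexp
  rw [Real.log_exp, Real.log_prod (s := univ) (fun j _ => (zpow_pos (F.αo_pos' j) _).ne')] at h
  rw [h]
  exact sum_congr rfl fun j _ => Real.log_zpow _ _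

/-! ### Virtual real sizes (the `F = 1` atoms) -/

/-- **`N · log θᵢ = Σⱼ Uᵢⱼ · log αoⱼ`.** [cite: Nesterenko2003, §3.5 (3.25); shape only] -/
theorem natCast_N_mul_lg (i : Fin S.n) : (F.N : ℝ) * S.lg i = ∑ j, (F.U i j : ℝ) * Real.log (F.αo j : ℝ) := by
  have h : ((S.α i : ℝ)) ^ F.N = ∏ j, ((F.αo j : ℝ)) ^ F.U i j := by exact_mod_cast F.hU i
  have h2 := congrArg Real.log h
  rw [Real.log_pow, Real.log_prod (s := univ) (fun j _ => (zpow_pos (F.αo_pos' j) _).ne')] at h2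
  unfold lg
  rw [h2]
  exact sum_congr rfl fun j _ => Real.log_zpow _ _

/-- **`N · Lsum μ = Σⱼ ν(μ)ⱼ · log αoⱼ`** — the exponent functional in virtual coordinates. [cite: Nesterenko2003, §3.5 (3.25); shape only] -/
theorem natCast_N_mul_Lsum (μ : Fin S.n → ℤ) : (F.N : ℝ) * S.Lsum μ = ∑ j, ((μ ᵥ* F.U) j : ℝ) * Real.log (F.αo j : ℝ) := by
  unfold Lsum
  rw [mul_sum]
  have e1 : ∀ i, (F.N : ℝ) * ((μ i : ℝ) * S.lg i) = ∑ j, (μ i : ℝ) * ((F.U i j : ℝ) * Real.log (F.αo j : ℝ)) := by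
    intro i
    rw [← mul_sum, ← F.natCast_N_mul_lg i]; ring
  simp_rw [e1]
  rw [sum_comm]
  refine sum_congr rfl fun j _ => ?_
  have hν : ((μ ᵥ* F.U) j : ℝ) = ∑ i, (μ i : ℝ) * (F.U i j : ℝ) := by
    simp only [Matrix.vecMul, dotProduct]; push_cast; rfl
  rw [hν, sum_mul]
  exact sum_congr rfl fun i _ => by ring

/-- **The virtual size of a monomial**: `|Lsum μ| ≤ Σⱼ (Bvⱼ/N)·Aoⱼ` for `|ν(μ)ⱼ| ≤ Bvⱼ` and `|log αoⱼ| ≤ Aoⱼ` (so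
`|∏ θᵢ^{μᵢ x}| = exp(x·Lsum μ) ≤ exp(|x|·Σ(Bvⱼ/N)Aoⱼ)` — print's `2^{−s}·n·L·|x|/2` with `Bvⱼ/N = σⱼ`). [cite: Nesterenko2003, §3.5 Lemma 3.11 (3.42), p. 74] -/
theorem abs_Lsum_le_of_vbox {Ao : Fin S.n → ℝ} (hAo : ∀ j, |Real.log (F.αo j : ℝ)| ≤ Ao j) {Bv : Fin S.n → ℕ}
    {μ : Fin S.n → ℤ} (hμ : ∀ j, |(μ ᵥ* F.U) j| ≤ (Bv j : ℤ)) :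
    |S.Lsum μ| ≤ ∑ j, ((Bv j : ℝ) / F.N) * Ao j := by
  have hN := F.N_pos'
  have h1 : (F.N : ℝ) * |S.Lsum μ| ≤ ∑ j, (Bv j : ℝ) * Ao j := by
    rw [← abs_of_pos hN, ← abs_mul, F.natCast_N_mul_Lsum]
    refine (abs_sum_le_sum_abs _ _).trans (sum_le_sum fun j _ => ?_)
    rw [abs_mul]
    have hb : |((μ ᵥ* F.U) j : ℝ)| ≤ (Bv j : ℝ) := by exact_mod_cast hμ j
    exact mul_le_mul hb (hAo j) (abs_nonneg _) (Nat.cast_nonneg _)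
  have h2 : ∑ j, (Bv j : ℝ) * Ao j = (F.N : ℝ) * ∑ j, ((Bv j : ℝ) / F.N) * Ao j := by
    rw [mul_sum]; refine sum_congr rfl fun j _ => ?_; field_simp
  rw [h2] at h1
  exact le_of_mul_le_mul_left h1 hN

/-- **The logarithms of the saturated basis**: `|log θᵢ| ≤ Σⱼ (|Uᵢⱼ|/N)·Aoⱼ`. [cite: Nesterenko2003, §3.5 (3.25); shape only] -/
theorem abs_lg_le_of_weights {Ao : Fin S.n → ℝ} (hAo : ∀ j, |Real.log (F.αo j : ℝ)| ≤ Ao j) (i : Fin S.n) :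
    |S.lg i| ≤ ∑ j, (|(F.U i j : ℝ)| / F.N) * Ao j := by
  have hN := F.N_pos'
  have h1 : (F.N : ℝ) * |S.lg i| ≤ ∑ j, |(F.U i j : ℝ)| * Ao j := by
    rw [← abs_of_pos hN, ← abs_mul, F.natCast_N_mul_lg]
    refine (abs_sum_le_sum_abs _ _).trans (sum_le_sum fun j _ => ?_)
    rw [abs_mul]
    exact mul_le_mul_of_nonneg_left (hAo j) (abs_nonneg _)
  have h2 : ∑ j, |(F.U i j : ℝ)| * Ao j = (F.N : ℝ) * ∑ j, (|(F.U i j : ℝ)| / F.N) * Ao j := by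
    rw [mul_sum]; refine sum_congr rfl fun j _ => ?_; field_simp
  rw [h2] at h1
  exact le_of_mul_le_mul_left h1 hN

/-- **The heights of the saturated basis**: `h(θᵢ) ≤ Σⱼ (|Uᵢⱼ|/N)·h(αoⱼ)`. [cite: Nesterenko2003, §3.5 Lemma 3.11; shape only] -/
theorem logHeight₁_le_of_sat (i : Fin S.n) :
    Height.logHeight₁ (S.α i) ≤ ∑ j, (|(F.U i j : ℝ)| / F.N) * Height.logHeight₁ (F.αo j) := by
  have hN := F.N_pos'
  have h := SatCoords.natCast_mul_logHeight₁_prod_zpow_le F.αo S.α F.U F.N F.αo_ne F.hU (Pi.single i 1)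
  have hprod : ∏ i', S.α i' ^ (Pi.single i (1 : ℤ) : Fin S.n → ℤ) i' = S.α i := by
    rw [Fintype.prod_eq_single i (fun i' hi' => by rw [Pi.single_eq_of_ne hi', zpow_zero]), Pi.single_eq_same, zpow_one]
  have hν : ∀ j, ((Pi.single i (1 : ℤ) : Fin S.n → ℤ) ᵥ* F.U) j = F.U i j := fun j => by
    rw [Matrix.single_one_vecMul]; rfl
  rw [hprod] at h
  simp_rw [hν] at h
  have h2 : ∑ j, (|F.U i j| : ℝ) * Height.logHeight₁ (F.αo j) = (F.N : ℝ) * ∑ j, (|(F.U i j : ℝ)| / F.N) * Height.logHeight₁ (F.αo j) := by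
    rw [mul_sum]; refine sum_congr rfl fun j _ => ?_; field_simp
  rw [h2] at h
  exact le_of_mul_le_mul_left h hN

/-- **The radicand heights of the half-step's Liouville base**: `log ∏ᵢ H(θᵢ) ≤ Σᵢ Σⱼ (|Uᵢⱼ|/N)·Vⱼ` for `h(αoⱼ) ≤ Vⱼ` (the (s2) atom of
R32/R34, virtual). [cite: Nesterenko2003, §4.3 (4.45) with Lemma 3.11 over K; shape only] -/
theorem log_heightProd_le_of_sat {V : Fin S.n → ℝ} (hV : ∀ j, Height.logHeight₁ (F.αo j) ≤ V j) :
    Real.log (heightProd S.α) ≤ ∑ i, ∑ j, (|(F.U i j : ℝ)| / F.N) * V j := by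
  refine S.log_heightProd_le_sum fun i => (F.logHeight₁_le_of_sat i).trans (sum_le_sum fun j _ => ?_)
  exact mul_le_mul_of_nonneg_left (hV j) (div_nonneg (abs_nonneg _) F.N_pos'.le)

/-! ### The k-step box: virtual clearing denominator -/

/-- The α-box exponent at the point `x` of the virtual box `Bv`: `Evⱼ(x) = ⌈Bvⱼ·|x|/N⌉`. [folklore] -/
def Ev (Bv : Fin S.n → ℕ) (x : ℤ) : Fin S.n → ℕ := fun j => (Bv j * x.natAbs + F.N - 1) / F.N

/-- Ceiling division `⌈a/m⌉ = (a + m − 1)/m`: `a ≤ m·⌈a/m⌉` and `⌈a/m⌉ ≤ a/m + 1`. [folklore] -/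
theorem ceilDiv_spec {m : ℕ} (hm : 0 < m) (a : ℕ) :
    a ≤ m * ((a + m - 1) / m) ∧ (((a + m - 1) / m : ℕ) : ℝ) ≤ (a : ℝ) / m + 1 := by
  constructor
  · have h := Nat.lt_div_mul_add (a := a + m - 1) hm
    rw [Nat.mul_comm m]
    omega
  · have hmr : (0 : ℝ) < m := by exact_mod_cast hm
    have h1 : ((a + m - 1) / m : ℕ) * m ≤ a + m - 1 := Nat.div_mul_le_self _ _
    have h3 : (((a + m - 1) / m * m : ℕ) : ℝ) ≤ ((a + m - 1 : ℕ) : ℝ) := by exact_mod_cast h1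
    have h4 : ((a + m - 1 : ℕ) : ℝ) ≤ (a : ℝ) + m := by exact_mod_cast (Nat.sub_le (a + m) 1)
    push_cast at h3
    rw [div_add_one hmr.ne', le_div_iff₀ hmr]
    linarith

/-- `Bvⱼ·|x| ≤ N·Evⱼ(x)` and `Evⱼ(x) ≤ Bvⱼ·|x|/N + 1`. [folklore] -/
theorem Ev_spec (Bv : Fin S.n → ℕ) (x : ℤ) (j : Fin S.n) :
    Bv j * x.natAbs ≤ F.N * F.Ev Bv x j ∧ (F.Ev Bv x j : ℝ) ≤ (Bv j : ℝ) * |(x : ℝ)| / F.N + 1 := by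
  have h := ceilDiv_spec F.hN (Bv j * x.natAbs)
  have hcast : ((Bv j * x.natAbs : ℕ) : ℝ) = (Bv j : ℝ) * |(x : ℝ)| := by push_cast; rw [Nat.cast_natAbs, Int.cast_abs]
  refine ⟨h.1, ?_⟩
  rw [← hcast]
  exact h.2

/-- **The virtual clearing denominator of the k-step box** at the point `x`: `Dmv Bv x = monDen αo (Ev Bv x)`.
[cite: Nesterenko2003, §3.5 Lemma 3.11; shape only] -/
def Dmv (Bv : Fin S.n → ℕ) (x : ℤ) : ℕ := MonomialDen.monDen F.αo (F.Ev Bv x)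

/-- `1 ≤ Dmv`. [folklore] -/
theorem one_le_Dmv (Bv : Fin S.n → ℕ) (x : ℤ) : 1 ≤ F.Dmv Bv x := MonomialDen.one_le_monDen _ F.αo_ne _

/-- **The monomials of the virtual box cleared**: for `|ν(μ)ⱼ| ≤ Bvⱼ`, `Dmv Bv x · ∏ⱼ θⱼ^{μⱼ·x} ∈ ℤ` (the Liouville denominator of the
k-step at `S(θ)`, N-free in logarithm). [cite: Nesterenko2003, §3.5 Lemma 3.11; shape only] -/
theorem exists_int_Dmv_mul_prod {Bv : Fin S.n → ℕ} {μ : Fin S.n → ℤ} (hμ : ∀ j, |(μ ᵥ* F.U) j| ≤ (Bv j : ℤ)) (x : ℤ) :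
    ∃ z : ℤ, ((F.Dmv Bv x : ℕ) : ℚ) * ∏ j, S.α j ^ (μ j * x) = z := by
  have hμx : (fun j => μ j * x) = x • μ := by funext j; simp [mul_comm]
  have hbox : ∀ j, |((fun j => μ j * x) ᵥ* F.U) j| ≤ (F.N : ℤ) * (F.Ev Bv x j : ℕ) := by
    intro j
    rw [hμx, Matrix.smul_vecMul, Pi.smul_apply, smul_eq_mul, abs_mul, mul_comm]
    have h1 : |(μ ᵥ* F.U) j| * |x| ≤ (Bv j : ℤ) * |x| := mul_le_mul_of_nonneg_right (hμ j) (abs_nonneg _)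
    have h2 : (Bv j : ℤ) * |x| ≤ (F.N : ℤ) * (F.Ev Bv x j : ℕ) := by
      have := (F.Ev_spec Bv x j).1
      rw [Int.abs_eq_natAbs]
      exact_mod_cast this
    exact h1.trans h2
  obtain ⟨z, hz, -⟩ := SatCoords.exists_int_monDen_mul_prod_zpow_sat F.αo S.α F.U F.N F.hαo S.α_pos F.hN F.hU (F.Ev Bv x) _ hbox
  exact ⟨z, hz⟩

/-- **The cost of the virtual k-step denominator**: `log Dmv Bv x ≤ 2|x|·Σⱼ (Bvⱼ/N)·Vⱼ + 2·Σⱼ Vⱼ` for `h(αoⱼ) ≤ Vⱼ`.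
[cite: Nesterenko2003, §3.5 Lemma 3.11 (3.42); shape only] -/
theorem log_Dmv_le_of_weights (Bv : Fin S.n → ℕ) (x : ℤ) {V : Fin S.n → ℝ} (hV : ∀ j, Height.logHeight₁ (F.αo j) ≤ V j) :
    Real.log (F.Dmv Bv x : ℝ) ≤ 2 * |(x : ℝ)| * ∑ j, ((Bv j : ℝ) / F.N) * V j + 2 * ∑ j, V j := by
  have h : Real.log (F.Dmv Bv x : ℝ) ≤ 2 * ∑ j, (F.Ev Bv x j : ℝ) * Height.logHeight₁ (F.αo j) :=
    MonomialDen.log_monDen_le _ F.αo_ne _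
  have h2 : ∑ j, (F.Ev Bv x j : ℝ) * Height.logHeight₁ (F.αo j) ≤ ∑ j, ((Bv j : ℝ) * |(x : ℝ)| / F.N + 1) * V j := by
    refine sum_le_sum fun j _ => ?_
    have hE := (F.Ev_spec Bv x j).2
    exact mul_le_mul hE (hV j) (Height.zero_le_logHeight₁ _) (by positivity)
  have h3 : ∑ j, ((Bv j : ℝ) * |(x : ℝ)| / F.N + 1) * V j = |(x : ℝ)| * ∑ j, ((Bv j : ℝ) / F.N) * V j + ∑ j, V j := by
    rw [mul_sum, ← sum_add_distrib]
    refine sum_congr rfl fun j _ => ?_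
    ring
  linarith

/-! ### The half-step floor box: virtual clearing denominator and virtual size of the rational part -/

/-- The column sums `Σᵢ |Uᵢⱼ|` of the saturation matrix. [folklore] -/
def colU (j : Fin S.n) : ℕ := ∑ i, (F.U i j).natAbs

/-- The α-box exponent of the floor half-point monomial `qEhZ μ s = ∏ θⱼ^{⌊μⱼ s/2⌋}`: `Ehvⱼ(s) = ⌈(|s|·Bvⱼ + Σᵢ|Uᵢⱼ|)/(2N)⌉`. [folklore] -/
def Ehv (Bv : Fin S.n → ℕ) (s : ℤ) : Fin S.n → ℕ := fun j => (s.natAbs * Bv j + F.colU j + 2 * F.N - 1) / (2 * F.N)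

/-- `|s|·Bvⱼ + Σᵢ|Uᵢⱼ| ≤ 2N·Ehvⱼ(s)` and `Ehvⱼ(s) ≤ (|s|·Bvⱼ + Σᵢ|Uᵢⱼ|)/(2N) + 1`. [folklore] -/
theorem Ehv_spec (Bv : Fin S.n → ℕ) (s : ℤ) (j : Fin S.n) :
    s.natAbs * Bv j + F.colU j ≤ 2 * F.N * F.Ehv Bv s j ∧
      (F.Ehv Bv s j : ℝ) ≤ (|(s : ℝ)| * (Bv j : ℝ) + F.colU j) / (2 * F.N) + 1 := by
  have hN : 0 < 2 * F.N := by have := F.hN; omega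
  have h := ceilDiv_spec hN (s.natAbs * Bv j + F.colU j)
  have hcast : ((s.natAbs * Bv j + F.colU j : ℕ) : ℝ) = |(s : ℝ)| * (Bv j : ℝ) + F.colU j := by
    push_cast; rw [Nat.cast_natAbs, Int.cast_abs]
  refine ⟨h.1, ?_⟩
  have h2 := h.2
  rw [hcast] at h2
  push_cast at h2
  exact h2

/-- **The virtual clearing denominator of the floor half-point monomials**: `Dhv Bv s = monDen αo (Ehv Bv s)`.
[cite: Nesterenko2003, §4.3 (4.50); shape only] -/
def Dhv (Bv : Fin S.n → ℕ) (s : ℤ) : ℕ := MonomialDen.monDen F.αo (F.Ehv Bv s)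

/-- `1 ≤ Dhv`. [folklore] -/
theorem one_le_Dhv (Bv : Fin S.n → ℕ) (s : ℤ) : 1 ≤ F.Dhv Bv s := MonomialDen.one_le_monDen _ F.αo_ne _

/-- **The virtual exponents of the floor vector**: `2·|ν(⌊μ s/2⌋)ⱼ| ≤ |s|·|ν(μ)ⱼ| + Σᵢ |Uᵢⱼ|` (from `2⌊μᵢs/2⌋ = μᵢs − εᵢ`,
`εᵢ ∈ {0,1}`). [cite: Nesterenko2003, §4.3 (4.50); shape only] -/
theorem two_mul_abs_vecMul_halfExp_le (μ : Fin S.n → ℤ) (s : ℤ) (j : Fin S.n) :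
    2 * |(S.halfExp μ s ᵥ* F.U) j| ≤ |s| * |(μ ᵥ* F.U) j| + ∑ i, |F.U i j| := by
  have hε : ∀ i, 2 * S.halfExp μ s i = μ i * s - (μ i * s) % 2 := fun i => by unfold halfExp; omega
  have hε01 : ∀ i, |(μ i * s) % 2| ≤ 1 := fun i => by
    rcases Int.emod_two_eq_zero_or_one (μ i * s) with h | h <;> simp [h]
  have e1 : 2 * (S.halfExp μ s ᵥ* F.U) j = s * (μ ᵥ* F.U) j - ∑ i, (μ i * s) % 2 * F.U i j := by
    simp only [Matrix.vecMul, dotProduct]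
    rw [mul_sum, mul_sum, ← sum_sub_distrib]
    refine sum_congr rfl fun i _ => ?_
    calc 2 * (S.halfExp μ s i * F.U i j) = (2 * S.halfExp μ s i) * F.U i j := by ring
      _ = (μ i * s - μ i * s % 2) * F.U i j := by rw [hε i]
      _ = s * (μ i * F.U i j) - μ i * s % 2 * F.U i j := by ring
  calc 2 * |(S.halfExp μ s ᵥ* F.U) j| = |2 * (S.halfExp μ s ᵥ* F.U) j| := by rw [abs_mul]; norm_num
    _ = |s * (μ ᵥ* F.U) j - ∑ i, (μ i * s) % 2 * F.U i j| := by rw [e1]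
    _ ≤ |s * (μ ᵥ* F.U) j| + |∑ i, (μ i * s) % 2 * F.U i j| := abs_sub _ _
    _ ≤ |s| * |(μ ᵥ* F.U) j| + ∑ i, |F.U i j| := by
        rw [abs_mul]
        refine add_le_add le_rfl ((abs_sum_le_sum_abs _ _).trans (sum_le_sum fun i _ => ?_))
        rw [abs_mul]
        exact (mul_le_mul_of_nonneg_right (hε01 i) (abs_nonneg _)).trans (by rw [one_mul])

/-- The floor vector's virtual exponents lie in the α-box `N·Ehv`: `|ν(⌊μ s/2⌋)ⱼ| ≤ N·Ehvⱼ(s)` for `|ν(μ)ⱼ| ≤ Bvⱼ`. [folklore] -/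
theorem abs_vecMul_halfExp_le {Bv : Fin S.n → ℕ} {μ : Fin S.n → ℤ} (hμ : ∀ j, |(μ ᵥ* F.U) j| ≤ (Bv j : ℤ)) (s : ℤ)
    (j : Fin S.n) : |(S.halfExp μ s ᵥ* F.U) j| ≤ (F.N : ℤ) * (F.Ehv Bv s j : ℕ) := by
  have h1 := F.two_mul_abs_vecMul_halfExp_le μ s j
  have h2 : |s| * |(μ ᵥ* F.U) j| + ∑ i, |F.U i j| ≤ |s| * (Bv j : ℤ) + (F.colU j : ℤ) := by
    have hc : (F.colU j : ℤ) = ∑ i, |F.U i j| := by simp only [colU, Nat.cast_sum, Int.natCast_natAbs]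
    rw [hc]; exact add_le_add (mul_le_mul_of_nonneg_left (hμ j) (abs_nonneg _)) le_rfl
  have h3 : |s| * (Bv j : ℤ) + (F.colU j : ℤ) ≤ 2 * ((F.N : ℤ) * (F.Ehv Bv s j : ℕ)) := by
    have := (F.Ehv_spec Bv s j).1
    have h4 : ((s.natAbs * Bv j + F.colU j : ℕ) : ℤ) ≤ ((2 * F.N * F.Ehv Bv s j : ℕ) : ℤ) := by exact_mod_cast this
    push_cast at h4
    linarith
  linarith

/-- **The rational part of the half-point monomial cleared VIRTUALLY**: for `|ν(μ)ⱼ| ≤ Bvⱼ`, `Dhv Bv s · qEhZ μ s ∈ ℤ`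
(`qEhZ μ s = ∏ θⱼ^{⌊μⱼ s/2⌋}`). [cite: Nesterenko2003, §4.3 (4.50); shape only] -/
theorem exists_int_Dhv_mul_qEhZ {Bv : Fin S.n → ℕ} {μ : Fin S.n → ℤ} (hμ : ∀ j, |(μ ᵥ* F.U) j| ≤ (Bv j : ℤ)) (s : ℤ) :
    ∃ z : ℤ, ((F.Dhv Bv s : ℕ) : ℚ) * S.qEhZ μ s = z := by
  obtain ⟨z, hz, -⟩ := SatCoords.exists_int_monDen_mul_prod_zpow_sat F.αo S.α F.U F.N F.hαo S.α_pos F.hN F.hU (F.Ehv Bv s)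
    (S.halfExp μ s) (F.abs_vecMul_halfExp_le hμ s)
  exact ⟨z, hz⟩

/-- **The cost of the virtual half-step denominator**: `log Dhv Bv s ≤ |s|·Σⱼ(Bvⱼ/N)Vⱼ + Σⱼ(Σᵢ|Uᵢⱼ|/N)Vⱼ + 2ΣⱼVⱼ` for `h(αoⱼ) ≤ Vⱼ`.
[cite: Nesterenko2003, §4.3 with Lemma 3.11; shape only] -/
theorem log_Dhv_le_of_weights (Bv : Fin S.n → ℕ) (s : ℤ) {V : Fin S.n → ℝ} (hV : ∀ j, Height.logHeight₁ (F.αo j) ≤ V j) :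
    Real.log (F.Dhv Bv s : ℝ) ≤
      |(s : ℝ)| * ∑ j, ((Bv j : ℝ) / F.N) * V j + ∑ j, ((F.colU j : ℝ) / F.N) * V j + 2 * ∑ j, V j := by
  have hNr := F.N_pos'
  have h : Real.log (F.Dhv Bv s : ℝ) ≤ 2 * ∑ j, (F.Ehv Bv s j : ℝ) * Height.logHeight₁ (F.αo j) :=
    MonomialDen.log_monDen_le _ F.αo_ne _
  have h2 : ∑ j, (F.Ehv Bv s j : ℝ) * Height.logHeight₁ (F.αo j) ≤
      ∑ j, ((|(s : ℝ)| * (Bv j : ℝ) + F.colU j) / (2 * F.N) + 1) * V j := by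
    refine sum_le_sum fun j _ => ?_
    have hE := (F.Ehv_spec Bv s j).2
    exact mul_le_mul hE (hV j) (Height.zero_le_logHeight₁ _) (by positivity)
  have h3 : 2 * ∑ j, ((|(s : ℝ)| * (Bv j : ℝ) + F.colU j) / (2 * F.N) + 1) * V j =
      |(s : ℝ)| * ∑ j, ((Bv j : ℝ) / F.N) * V j + ∑ j, ((F.colU j : ℝ) / F.N) * V j + 2 * ∑ j, V j := by
    rw [mul_sum, mul_sum, mul_sum, ← sum_add_distrib, ← sum_add_distrib]
    refine sum_congr rfl fun j _ => ?_
    simp only [div_eq_mul_inv, mul_inv]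
    ring
  linarith

/-- **The virtual SIZE of the rational part at a half point**: for `|ν(μ)ⱼ| ≤ Bvⱼ` and `|log αoⱼ| ≤ Aoⱼ`,
`qEhZ μ s ≤ exp(|s|/2 · Σⱼ (Bvⱼ/N)·Aoⱼ + ½ · Σᵢ Σⱼ (|Uᵢⱼ|/N)·Aoⱼ)` (the slab form `ArchG3HalfSupply.qEhZ_le_exp_slab` with the virtual
exponent size and the virtual logarithms of the basis). [cite: Nesterenko2003, §4.3 (4.44), p. 92; shape only] -/
theorem qEhZ_le_exp_of_vbox {Ao : Fin S.n → ℝ} (hAo : ∀ j, |Real.log (F.αo j : ℝ)| ≤ Ao j) {Bv : Fin S.n → ℕ}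
    {μ : Fin S.n → ℤ} (hμ : ∀ j, |(μ ᵥ* F.U) j| ≤ (Bv j : ℤ)) (s : ℤ) :
    (S.qEhZ μ s : ℝ) ≤
      Real.exp ((∑ j, ((Bv j : ℝ) / F.N) * Ao j) * (|(s : ℝ)| / 2) + (∑ i, ∑ j, (|(F.U i j : ℝ)| / F.N) * Ao j) / 2) :=
  S.qEhZ_le_exp_slab (fun i => F.abs_lg_le_of_weights hAo i) μ s (F.abs_Lsum_le_of_vbox hAo hμ)

end SatData

end ArchG3Setup

end Summit.ABC.StewartYu

end
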